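import Literature.Probability.RandomPlanarGeometry.SAWQuinticConnectiveConstantLower
import HarnessLib

/-!
# `μ(ℤ⁵) > 7.38`: the irreducible-bridge certificate of `SAWQuinticConnectiveConstantLower.lean` at length `8`

Topic `Literature/Probability/RandomPlanarGeometry` (continues `SAWQuinticConnectiveConstantLower.lean`: the ten-letter
word model of `ℤ⁵`, the verified acceptance test `QuinticIrrCert.WordOK`, the list certificate `QuinticIrrCert.certL`
with its soundness `QuinticIrrCert.le_of_certL` (standard axioms), the untrusted half-space search
`QuinticIrrCert.dfs`, and the certified counts `λ_n(ℤ⁵) ≥ 1, 8, 56, 392, 2696, 18640, 128728` for `n ≤ 7`). One more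
evaluation, `λ_8(ℤ⁵) ≥ 899 384` (the exact value), kept in its own file because its `native_decide` is the expensive
one, and the resulting numeral: `Σ_{n ≤ 8} λ_n(ℤ⁵) (50/369)^n ≥ 1.0033 > 1`, hence **`μ(ℤ⁵) > 369/50 = 7.38`** by
Kesten's inequality `Σ_n λ_n μ^{-n} ≤ 1` (`Zd.inv_lt_connectiveConstant_of_one_lt_sum`; tree so far `7.18`; the
truncation at `n ≤ 8` cannot certify `7.39`, its root is `7.3844`). Printed: `μ(ℤ⁵) ≥ 8.828529` (Hara–Slade–Sokal
1993), estimate `8.8386`; this bound is weaker but kernel-checked. Computational class: axioms standard plus the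
`native_decide` count certificates (`Lean.ofReduceBool`).
-/

open Finset Literature.Probability.LatticeModels
open scoped BigOperators

namespace Literature.Probability.RandomPlanarGeometry.SAW.Zd

namespace QuinticIrrCert

/-! ### The evaluation at `n = 8` (computational class) -/

/-- `λ_8(ℤ⁵) ≥ 899384`. [cite: Jensen2004SAWLowerBounds, §2] [cite: MadrasSlade1993, Definition 4.2.1 (p. 89)] -/
theorem le_lambda_eight : 899384 ≤ irreducibleBridgeCount 5 8 := le_of_certL (L := dfs 8) (by native_decide)

end QuinticIrrCert

/-! ### The numeral -/

open QuinticIrrCert in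
/-- **`μ(ℤ⁵) > 7.38`**: `369/50 < connectiveConstant 5`, from `Σ_{n ≤ 8} λ_n(ℤ⁵) (50/369)^n > 1` and Kesten's
inequality. [cite: MadrasSlade1993, Table 1.1 (p. 12), d = 5 row; §4.2, eq. (4.2.3)–(4.2.4) (pp. 90–91)]
[cite: HaraSladeSokal1993, Table 1 (p. 3) and Table 2 (p. 12)] [cite: Kesten1963SAW, §4]
[cite: Jensen2004SAWLowerBounds, §2 (Kesten's truncation principle)] -/
theorem connectiveConstant_five_gt_738_div_100 : (369 : ℝ) / 50 < connectiveConstant 5 := by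
  have hx : (0 : ℝ) < 50 / 369 := by norm_num
  have key : (1 : ℝ) < ∑ k ∈ Finset.range 9, (irreducibleBridgeCount 5 k : ℝ) * (50 / 369) ^ k := by
    have h1 : (1 : ℝ) ≤ irreducibleBridgeCount 5 1 := by exact_mod_cast le_lambda_one
    have h2 : (8 : ℝ) ≤ irreducibleBridgeCount 5 2 := by exact_mod_cast le_lambda_two
    have h3 : (56 : ℝ) ≤ irreducibleBridgeCount 5 3 := by exact_mod_cast le_lambda_three
    have h4 : (392 : ℝ) ≤ irreducibleBridgeCount 5 4 := by exact_mod_cast le_lambda_four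
    have h5 : (2696 : ℝ) ≤ irreducibleBridgeCount 5 5 := by exact_mod_cast le_lambda_five
    have h6 : (18640 : ℝ) ≤ irreducibleBridgeCount 5 6 := by exact_mod_cast le_lambda_six
    have h7 : (128728 : ℝ) ≤ irreducibleBridgeCount 5 7 := by exact_mod_cast le_lambda_seven
    have h8 : (899384 : ℝ) ≤ irreducibleBridgeCount 5 8 := by exact_mod_cast le_lambda_eight
    simp only [Finset.sum_range_succ, Finset.sum_range_zero, irreducibleBridgeCount_zero]
    generalize irreducibleBridgeCount 5 1 = a1 at h1 ⊢
    generalize irreducibleBridgeCount 5 2 = a2 at h2 ⊢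
    generalize irreducibleBridgeCount 5 3 = a3 at h3 ⊢
    generalize irreducibleBridgeCount 5 4 = a4 at h4 ⊢
    generalize irreducibleBridgeCount 5 5 = a5 at h5 ⊢
    generalize irreducibleBridgeCount 5 6 = a6 at h6 ⊢
    generalize irreducibleBridgeCount 5 7 = a7 at h7 ⊢
    generalize irreducibleBridgeCount 5 8 = a8 at h8 ⊢
    push_cast
    norm_num
    linarith [h1, h2, h3, h4, h5, h6, h7, h8]
  have := inv_lt_connectiveConstant_of_one_lt_sum 5 _ hx key
  rwa [inv_div] at this

end Literature.Probability.RandomPlanarGeometry.SAW.Zd
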